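import Summits.Ventures.Crystal3D.Theorems.StickyWulffConstantNoReconstructionGainGrainGeom
import Summits.Ventures.Crystal3D.Theorems.StickyWulffConstantNoReconstructionGainGrainCount
import HarnessLib

/-!
# A steep transport family pays one unit of deficiency per toucher

HONEST FRAMING. Part of the venture `Summits/Ventures/Crystal3D` (cell `crystal3d-full`), helper
`--supports` the crux `NoReconstructionGain` (stmt-Ventures-19144, route
`route-Ventures-StickyWulffConstant`), line `adhesion`, GRAIN RUNG.  The bridge between the slab
geometry (`…GrainGeom`) and the abstract segment count (`…GrainCount`).

Setting: the slab sample `P` (`ν = e₃`, `R = 4`, `ρ ≥ 4`) inside a unit packing `X`; an index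
type `ι` with a position map `gp : ι → ℝ³` and a finite index set `Q'` whose positions are balls
of `X \ P`; an injective "transport" map `T : ι → ι` whose steps have length `≤ 1` and raise the
height `(gp ·)₂` by at least `19/100` (resp. lower it by at least `19/100`).  If `Ta ⊆ Q'`
indexes balls in the band `[−4h, −5h + 1]` above the top face and `Tb ⊆ Q'` balls in the band
`[−9h − 1, −10h]` below the bottom face, all of lateral radius `≤ ρ − 2` (the TOUCHERS of core
sites), then `#Ta + #Tb ≤ #{z ∈ Q' : T z ∉ Q'}` (`card_touchers_le_seg_of_up`, `…_of_down`):
by slot exclusion an above-toucher has no `T`-predecessor in `Q'` and a below-toucher no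
`T`-successor (mirror for falling families), and the segment count of `…GrainCount` applies with
the mid-plane `−7h` as the separating level.

WHAT THIS IS NOT: the rung itself; rung F-C1 not moved.
-/

noncomputable section

namespace Summit.Ventures.Crystal3D.Theorems

open Summit.Ventures.Crystal3D Finset Real
open Literature.MathematicalPhysics.StatisticalMechanics (fccStacking)
open scoped InnerProductSpace

variable {ι : Type*} [DecidableEq ι]

/-- **Rising family.**  See the module docstring: touchers of core sites are counted by distinct
segments of a transport family whose steps rise by at least `19/100`. -/
theorem card_touchers_le_seg_of_up (ρ : ℝ) (hρ : 4 ≤ ρ)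
    (X P : Finset (EuclideanSpace ℝ (Fin 3)))
    (hX : ∀ p ∈ X, ∀ q ∈ X, p ≠ q → 1 ≤ dist p q) (hPX : P ⊆ X)
    (hP : ∀ p, p ∈ P ↔ (p ∈ fccStacking 1 (Real.sqrt (2 / 3)) ∧ -8 ≤ p 2 ∧ p 2 ≤ -4 ∧
      p 0 ^ 2 + p 1 ^ 2 ≤ ρ ^ 2))
    (gp : ι → EuclideanSpace ℝ (Fin 3)) (Q' : Finset ι) (hQ' : ∀ z ∈ Q', gp z ∈ X \ P)
    (T : ι → ι) (hT : Function.Injective T)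
    (hadj : ∀ z, dist (gp (T z)) (gp z) ≤ 1)
    (hslope : ∀ z, (gp z) 2 + 19 / 100 ≤ (gp (T z)) 2)
    (Ta Tb : Finset ι) (hTa : Ta ⊆ Q') (hTb : Tb ⊆ Q')
    (hTa_band : ∀ z ∈ Ta, -(4 * Real.sqrt (2 / 3)) ≤ (gp z) 2 ∧
      (gp z) 2 ≤ -(5 * Real.sqrt (2 / 3)) + 1 ∧ (gp z) 0 ^ 2 + (gp z) 1 ^ 2 ≤ (ρ - 2) ^ 2)
    (hTb_band : ∀ z ∈ Tb, -(9 * Real.sqrt (2 / 3)) - 1 ≤ (gp z) 2 ∧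
      (gp z) 2 ≤ -(10 * Real.sqrt (2 / 3)) ∧ (gp z) 0 ^ 2 + (gp z) 1 ^ 2 ≤ (ρ - 2) ^ 2) :
    Ta.card + Tb.card ≤ (Q'.filter fun z => T z ∉ Q').card := by
  obtain ⟨hh2, hh45, hh89⟩ := sqrt_two_thirds_bounds
  refine card_add_card_le_card_filter_succ_not_mem Q' T hT (fun z => (gp z) 2)
    (-(7 * Real.sqrt (2 / 3))) (fun z => by linarith [hslope z]) Ta Tb hTa hTb
    (fun z hz => by linarith [(hTa_band z hz).1]) (fun z hz => by linarith [(hTb_band z hz).2.1])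
    ?_ ?_
  · -- an above-toucher has no predecessor: the predecessor slot is in the forbidden region
    intro z hz w hw hwz
    obtain ⟨h1, h2, h3⟩ := hTa_band z hz
    have hy : gp w ∉ X \ P :=
      not_mem_sdiff_of_slot_above ρ hρ X P hX hPX hP (gp z) (gp w) h1 h2 h3
        (by rw [← hwz]; rw [dist_comm]; exact hadj w) (by rw [← hwz]; linarith [hslope w])
    exact hy (hQ' w hw)
  · -- a below-toucher has no successor
    intro z hz hTz
    obtain ⟨h1, h2, h3⟩ := hTb_band z hz
    have hy : gp (T z) ∉ X \ P :=
      not_mem_sdiff_of_slot_below ρ hρ X P hX hPX hP (gp z) (gp (T z)) h1 h2 h3 (hadj z)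
        (by linarith [hslope z])
    exact hy (hQ' (T z) hTz)

/-- **Falling family.**  Mirror statement for a transport family whose steps LOWER the height by
at least `19/100`. -/
theorem card_touchers_le_seg_of_down (ρ : ℝ) (hρ : 4 ≤ ρ)
    (X P : Finset (EuclideanSpace ℝ (Fin 3)))
    (hX : ∀ p ∈ X, ∀ q ∈ X, p ≠ q → 1 ≤ dist p q) (hPX : P ⊆ X)
    (hP : ∀ p, p ∈ P ↔ (p ∈ fccStacking 1 (Real.sqrt (2 / 3)) ∧ -8 ≤ p 2 ∧ p 2 ≤ -4 ∧
      p 0 ^ 2 + p 1 ^ 2 ≤ ρ ^ 2))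
    (gp : ι → EuclideanSpace ℝ (Fin 3)) (Q' : Finset ι) (hQ' : ∀ z ∈ Q', gp z ∈ X \ P)
    (T : ι → ι) (hT : Function.Injective T)
    (hadj : ∀ z, dist (gp (T z)) (gp z) ≤ 1)
    (hslope : ∀ z, (gp (T z)) 2 + 19 / 100 ≤ (gp z) 2)
    (Ta Tb : Finset ι) (hTa : Ta ⊆ Q') (hTb : Tb ⊆ Q')
    (hTa_band : ∀ z ∈ Ta, -(4 * Real.sqrt (2 / 3)) ≤ (gp z) 2 ∧
      (gp z) 2 ≤ -(5 * Real.sqrt (2 / 3)) + 1 ∧ (gp z) 0 ^ 2 + (gp z) 1 ^ 2 ≤ (ρ - 2) ^ 2)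
    (hTb_band : ∀ z ∈ Tb, -(9 * Real.sqrt (2 / 3)) - 1 ≤ (gp z) 2 ∧
      (gp z) 2 ≤ -(10 * Real.sqrt (2 / 3)) ∧ (gp z) 0 ^ 2 + (gp z) 1 ^ 2 ≤ (ρ - 2) ^ 2) :
    Ta.card + Tb.card ≤ (Q'.filter fun z => T z ∉ Q').card := by
  obtain ⟨hh2, hh45, hh89⟩ := sqrt_two_thirds_bounds
  refine card_add_card_le_card_filter_succ_not_mem' Q' T hT (fun z => (gp z) 2)
    (-(7 * Real.sqrt (2 / 3))) (fun z => by linarith [hslope z]) Ta Tb hTa hTb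
    (fun z hz => by linarith [(hTa_band z hz).1]) (fun z hz => by linarith [(hTb_band z hz).2.1])
    ?_ ?_
  · -- an above-toucher has no successor: the successor slot is in the forbidden region
    intro z hz hTz
    obtain ⟨h1, h2, h3⟩ := hTa_band z hz
    have hy : gp (T z) ∉ X \ P :=
      not_mem_sdiff_of_slot_above ρ hρ X P hX hPX hP (gp z) (gp (T z)) h1 h2 h3 (hadj z)
        (by linarith [hslope z])
    exact hy (hQ' (T z) hTz)
  · -- a below-toucher has no predecessor
    intro z hz w hw hwz
    obtain ⟨h1, h2, h3⟩ := hTb_band z hz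
    have hy : gp w ∉ X \ P :=
      not_mem_sdiff_of_slot_below ρ hρ X P hX hPX hP (gp z) (gp w) h1 h2 h3
        (by rw [← hwz]; rw [dist_comm]; exact hadj w) (by rw [← hwz]; linarith [hslope w])
    exact hy (hQ' w hw)

end Summit.Ventures.Crystal3D.Theorems

end
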